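import Summits.Ventures.PercRepro.RankDistTightSimple
import Summits.Ventures.PercRepro.RankDistReduction

/-!
# PercRepro — the cumulative shadow inequality on the tight layer REDUCES TO SIMPLE, COLOOP-FREE MATROIDS
(p9, gen 19)

`RankDistTightSimple` strips loops (they empty the bottom family) and parallel pairs (the exact split
`s_{u+1}(M) = 3·s_u(M ／ x ＼ x')`); g18's `shadowCumulative_of_isColoop` (`RankDistColoop`) strips a coloop `e`
— `M ∖ e` is again on the tight layer, for `(p − 1, q)`, and at `p = q + 2` the inequality for `M ∖ e` at
`(q + 2, q + 1)` is vacuous. Hence (**`shadowCumulative_tight_of_core`**, strong induction on `|E|`): if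
`ShadowCumulative N p q` holds on every matroid `N` of the tight layer with `q + 2 ≤ p` that is loopless, has no
parallel pair and no coloop — the tight layer's irreducible class (g18: every coloop-free tight-layer matroid has
no free element) — then it holds on every matroid of the tight layer with `q + 2 ≤ p`. Nothing here is a statement
about any window of the crux.
-/

namespace PercRepro.RankDist

open Set Finset _root_.Matroid PercRepro.ThmH

variable {α : Type} [DecidableEq α] (M : Matroid α) [M.Finite]

/-- Deleting an element of `E` drops the ground count by one. -/
lemma card_gr_delete_add_one {e : α} (he : e ∈ M.E) : (gr (M.delete {e})).card + 1 = (gr M).card := by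
  have heE : e ∈ gr M := by rw [← Finset.mem_coe, coe_gr]; exact he
  rw [gr_delete, Finset.card_erase_of_mem heE]
  have := Finset.card_pos.2 ⟨e, heE⟩
  omega

/-- At `p = q + 2` the cumulative shadow inequality at `(q + 2, q + 1)` has no level to check. -/
lemma shadowCumulative_succ_succ_self (q : ℕ) : ShadowCumulative M (q + 2) (q + 1) := by
  intro u h1 h2
  omega

/-- **THE CUMULATIVE SHADOW INEQUALITY ON THE TIGHT LAYER REDUCES TO SIMPLE, COLOOP-FREE MATROIDS.** If
`ShadowCumulative N p q` holds for every loopless matroid `N` without parallel pairs and without coloops with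
`|E| = p + q`, `ρ(E) = p`, `q + 2 ≤ p`, then it holds for every finite matroid of the tight layer with
`q + 2 ≤ p` (strong induction on `|E|`: loops empty the bottom family, a parallel pair reduces to
`M ／ x ＼ x'` at `(p − 1, q − 1)`, a coloop to `M ∖ e` at `(p − 1, q)`, `q = 0` is `shadowCumulative_zero`). -/
theorem shadowCumulative_tight_of_core
    (H : ∀ (N : Matroid α) [N.Finite] (p q : ℕ), (gr N).card = p + q → N.eRank = (p : ℕ∞) → q + 2 ≤ p →
      (∀ e ∈ N.E, N.IsNonloop e) → (∀ e ∈ N.E, ∀ f ∈ N.E, e ≠ f → f ∉ N.closure {e}) →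
      (∀ e ∈ N.E, ¬ N.IsColoop e) → ShadowCumulative N p q) :
    ∀ (n : ℕ) (N : Matroid α) [N.Finite] (p q : ℕ), (gr N).card = n → n = p + q →
      N.eRank = (p : ℕ∞) → q + 2 ≤ p → ShadowCumulative N p q := by
  intro n
  refine Nat.strong_induction_on n ?_
  intro n ih N _ p q hNn hn hr hqp
  by_cases hq : q = 0
  · subst hq; exact shadowCumulative_zero N p hr
  by_cases hloop : ∀ e ∈ N.E, N.IsNonloop e
  · by_cases hsimp : ∀ e ∈ N.E, ∀ f ∈ N.E, e ≠ f → f ∉ N.closure {e}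
    · by_cases hcol : ∀ e ∈ N.E, ¬ N.IsColoop e
      · exact H N p q (hNn.trans hn) hr hqp hloop hsimp hcol
      · -- a coloop: `M ∖ e` on the tight layer of `(p − 1, q)`
        push Not at hcol
        obtain ⟨e, heE, he⟩ := hcol
        obtain ⟨q', rfl⟩ : ∃ q', q = q' + 1 := ⟨q - 1, by omega⟩
        obtain ⟨p', rfl⟩ : ∃ p', p = p' + 1 := ⟨p - 1, by omega⟩
        have hcard := card_gr_delete_add_one N heE
        have hrank := eRank_delete_of_isColoop_add_one N he
        rw [hr] at hrank
        have hrank' : (N.delete {e}).eRank = (p' : ℕ∞) := by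
          have h : (N.delete {e}).eRank + 1 = (p' : ℕ∞) + 1 := by rw [hrank]; push_cast; rfl
          exact WithTop.add_right_cancel WithTop.one_ne_top h
        have hD : ShadowCumulative (N.delete {e}) p' (q' + 1) := by
          by_cases hp : q' + 3 ≤ p'
          · exact ih (gr (N.delete {e})).card (by omega) (N.delete {e}) p' (q' + 1) rfl (by omega) hrank' hp
          · obtain rfl : p' = q' + 2 := by omega
            exact shadowCumulative_succ_succ_self (N.delete {e}) q'
        exact shadowCumulative_of_isColoop N he hr hD
    · -- a parallel pair: `M ／ x ＼ x'` on the tight layer of `(p − 1, q − 1)`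
      push Not at hsimp
      obtain ⟨x, hxE, x', hx'E, hne, hxx'⟩ := hsimp
      have hx : N.IsNonloop x := hloop x hxE
      have hx' : N.IsNonloop x' := hloop x' hx'E
      obtain ⟨q', rfl⟩ : ∃ q', q = q' + 1 := ⟨q - 1, by omega⟩
      obtain ⟨p', rfl⟩ : ∃ p', p = p' + 1 := ⟨p - 1, by omega⟩
      have hcard := card_gr_parallelMinor N hx hx' hne
      have hrank := eRank_parallelMinor_add_one N hx hxx' hne
      rw [hr] at hrank
      have hrank' : ((N.contract {x}).delete {x'}).eRank = (p' : ℕ∞) := by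
        have h : ((N.contract {x}).delete {x'}).eRank + 1 = (p' : ℕ∞) + 1 := by rw [hrank]; push_cast; rfl
        exact WithTop.add_right_cancel WithTop.one_ne_top h
      have ih' := ih (gr ((N.contract {x}).delete {x'})).card (by omega) ((N.contract {x}).delete {x'})
        p' q' rfl (by omega) hrank' (by omega)
      exact shadowCumulative_of_parallel N (p := p') (q := q') (by omega) hx hx' hxx' hne ih'
  · -- a loop empties the bottom family
    push Not at hloop
    obtain ⟨e, heE, he⟩ := hloop
    have hl : N.IsLoop e := by
      by_contra h
      exact he ((not_isLoop_iff heE).1 h)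
    exact shadowCumulative_of_Uq_eq_empty N (Uq_eq_empty_of_isLoop_tight N (hNn.trans hn) hl)

end PercRepro.RankDist
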